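import Summits.Ventures.LatticeQCDFlow.Scaling.ResolventLaw
import Summits.Ventures.LatticeQCDFlow.Scaling.StarHubChainFirstOrder

/-!
HONEST FRAMING: exact (Metropolis-corrected) sampling algorithms for lattice gauge theory; figures
of merit are autocorrelation/cost numbers at stated couplings and volumes; no continuum-physics
claim.

# ResolventComparison — TWO GEOMETRIC RESOLVENTS FROM THE SAME START DIFFER BY `τ = σ/(1−σ)` TIMES THE FIRST LAW'S AVERAGE OF THE ONE-STEP DIFFERENCE APPLIED TO THE SECOND
# CHAIN'S VALUE FUNCTION: `E_u f − E_u' f = (σ/(1−σ))·Σ_h u(h)·Σ_v (K − K')(h,v)·F'(v)`; FOR THE STAR, `K_X − K_Y` IS CARRIED BY THE DIFFERING CONTENTS, SO THE TWO END-HUB LAWS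
# OF A PAIR STATE DIFFER BY AT MOST `2τΔ/K` IN EVERY `[0,1]`-VALUED FUNCTIONAL (lean-2 GEN-36, ours)

Venture-side (OURS).  Cell `lqcd-flow` (pub-lqcd), unit `pub-lqcd-lean-2-g36`, 2026-08-29.  Chapter W (item 1 (i) at finite swap odds), file 8: the perturbation route.  The cycle-end
gain `G(u_X,u_Y) = u_X(A) − u_Y(A) − Σ_C (u_Y − u_X)⁺` (chapter V file 2) compares the two ONE-COPY end-hub laws content by content, and the two copies' hub chains `K_X`, `K_Y` differ
only through the `Δ` differing level contents.  §1 (generic, `Scaling/ResolventLaw` setting): the VALUE FUNCTION `F' = (1−σ)f + σK'F'` of the second chain gives `E_{u'} f = Σ ν F'`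
(`geomResolvent_expect_eq_value`) and the COMPARISON IDENTITY `E_u f − E_{u'} f = (σ/(1−σ))·Σ_h u(h)·Σ_v (K(h,v) − K'(h,v))·F'(v)` (`geomResolvent_compare`) for two resolvents from the
same initial law; with row sums equal the inner sum is `Σ_v (K − K')(h,v)(F'(v) − F'(h))`, so `|E_u f − E_{u'} f| ≤ (σ/(1−σ))·sup_h Σ_v |K − K'|(h,v)·osc F'` (`geomResolvent_compare_le`),
and `osc F' ≤ osc f` (`geomValue_mem`).  §2 (the star): `K_X(h,v) − K_Y(h,v) = ((N_X−N_Y)(v)/K)·acc(h,v)` off the diagonal for contents legal in both (`Scaling/StarHubChainFirstOrder`),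
hence `Σ_v |K_X − K_Y|(h,v) ≤ 2Δ/K` (`starHub_rowDiff_le`) and **`|E_{u_X} f − E_{u_Y} f| ≤ (σ/(1−σ))·(2Δ/K)` for every `f` with values in `[0,1]`** when both resolvents only
visit contents legal in both (`starHub_endHub_compare_le`; the general statement carries the legality set as a hypothesis).  Hypothesis-equations, no definitions.

## What is proved

* §1 `geomValue_mem` (`m ≤ f ≤ M ⇒ m ≤ F' ≤ M`), **`geomResolvent_expect_eq_value`**, **`geomResolvent_compare`**, `geomResolvent_compare_rowsum`, **`geomResolvent_compare_le`**.
* §2 `starHub_rowDiff_le`, **`starHub_endHub_compare_le`**.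

Reading (no numerics implied): first order in `τΔ/K`; the binding inequality of MEMO-gen36 §3 is second order, so this identity is the starting point (iterate it once on `F'`), not the
end.  NOT CLAIMED: any certificate.  Literature grade (cell rule): OWN, elementary; nothing cited as a fact; no new bib keys.
-/

open Finset

namespace Summit.Ventures.LatticeQCDFlow.Scaling

section Compare
variable {S : Type*} [Fintype S]
variable {K K' : S → S → ℝ} {σ : ℝ} {ν u u' : S → ℝ} {f F' : S → ℝ}

/-! ## §1 The comparison identity -/

/-- **Value functions stay in the range of `f`:** if `K' ≥ 0` has row sums one, `0 ≤ σ < 1`, `F' = (1−σ)f + σK'F'` and `m ≤ f ≤ M`, then `m ≤ F' ≤ M`. [ours] -/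
theorem geomValue_mem (hK0 : ∀ a b, 0 ≤ K' a b) (hK1 : ∀ a, ∑ b, K' a b = 1) (hσ0 : 0 ≤ σ) (hσ1 : σ < 1)
    (hF : ∀ v, F' v = (1 - σ) * f v + σ * ∑ w, K' v w * F' w) {m M : ℝ} (hfm : ∀ v, m ≤ f v) (hfM : ∀ v, f v ≤ M) (v : S) :
    m ≤ F' v ∧ F' v ≤ M := by
  classical
  -- the maximum of `F'` is attained somewhere; there `F' ≤ (1−σ)M + σ·max F'`
  have hne : (univ : Finset S).Nonempty := ⟨v, mem_univ v⟩
  obtain ⟨vM, _, hvM⟩ := exists_max_image univ F' hne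
  obtain ⟨vm, _, hvm⟩ := exists_min_image univ F' hne
  have hmax : F' vM ≤ M := by
    have h1 : ∑ w, K' vM w * F' w ≤ F' vM := by
      calc ∑ w, K' vM w * F' w ≤ ∑ w, K' vM w * F' vM := sum_le_sum fun w _ => mul_le_mul_of_nonneg_left (hvM w (mem_univ w)) (hK0 vM w)
        _ = F' vM := by rw [← sum_mul, hK1, one_mul]
    have h2 := hF vM
    nlinarith [hfM vM, mul_le_mul_of_nonneg_left h1 hσ0]
  have hmin : m ≤ F' vm := by
    have h1 : F' vm ≤ ∑ w, K' vm w * F' w := by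
      calc F' vm = ∑ w, K' vm w * F' vm := by rw [← sum_mul, hK1, one_mul]
        _ ≤ ∑ w, K' vm w * F' w := sum_le_sum fun w _ => mul_le_mul_of_nonneg_left (hvm w (mem_univ w)) (hK0 vm w)
    have h2 := hF vm
    nlinarith [hfm vm, mul_le_mul_of_nonneg_left h1 hσ0]
  exact ⟨hmin.trans (hvm v (mem_univ v)), (hvM v (mem_univ v)).trans hmax⟩

/-- **`E_{u'} f = Σ ν F'`** for the value function `F' = (1−σ)f + σK'F'` of the chain of `u'` (`u' ≥ 0`, `σ < 1`). [ours] -/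
theorem geomResolvent_expect_eq_value (hσ1 : σ < 1) (hu' : ∀ v, u' v = (1 - σ) * ν v + σ * ∑ h, u' h * K' h v) (hu'0 : ∀ v, 0 ≤ u' v)
    (hF : ∀ v, F' v = (1 - σ) * f v + σ * ∑ w, K' v w * F' w) : ∑ v, u' v * f v = ∑ v, ν v * F' v :=
  le_antisymm (geomResolvent_expect_le_of_supersolution hσ1 hu' hu'0 fun v => (hF v).symm.le)
    (geomResolvent_expect_ge_of_subsolution hσ1 hu' hu'0 fun v => (hF v).le)

/-- **THE COMPARISON IDENTITY.**  `u = (1−σ)ν + σuK`, `u' = (1−σ)ν + σu'K'` (same `ν`, `σ < 1`, `u' ≥ 0`), `F'` the value function of `K'` for `f`: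
`E_u f − E_{u'} f = (σ/(1−σ))·Σ_h u(h)·Σ_v (K(h,v) − K'(h,v))·F'(v)`. [ours] -/
theorem geomResolvent_compare (hσ1 : σ < 1) (hu : ∀ v, u v = (1 - σ) * ν v + σ * ∑ h, u h * K h v)
    (hu' : ∀ v, u' v = (1 - σ) * ν v + σ * ∑ h, u' h * K' h v) (hu'0 : ∀ v, 0 ≤ u' v)
    (hF : ∀ v, F' v = (1 - σ) * f v + σ * ∑ w, K' v w * F' w) :
    ∑ v, u v * f v - ∑ v, u' v * f v = σ / (1 - σ) * ∑ h, u h * ∑ v, (K h v - K' h v) * F' v := by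
  have hσ : (1 - σ) ≠ 0 := by intro h; linarith
  rw [geomResolvent_expect_eq_value hσ1 hu' hu'0 hF]
  -- the resolvent identity for `u` applied to `F'`: `Σ u F' − σ Σ u (K F') = (1−σ) Σ ν F'`
  have h1 : ∑ v, u v * F' v = (1 - σ) * ∑ v, ν v * F' v + σ * ∑ h, u h * ∑ v, K h v * F' v := by
    calc ∑ v, u v * F' v = ∑ v, ((1 - σ) * ν v + σ * ∑ h, u h * K h v) * F' v := sum_congr rfl fun v _ => by rw [hu v]
      _ = (1 - σ) * ∑ v, ν v * F' v + σ * ∑ v, (∑ h, u h * K h v) * F' v := by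
          rw [mul_sum, mul_sum, ← sum_add_distrib]; exact sum_congr rfl fun v _ => by ring
      _ = (1 - σ) * ∑ v, ν v * F' v + σ * ∑ h, u h * ∑ v, K h v * F' v := by rw [geomResolvent_sum_swap]
  -- `F' − σK'F' = (1−σ)f`, integrated against `u`
  have h2 : ∑ v, u v * F' v = (1 - σ) * ∑ v, u v * f v + σ * ∑ h, u h * ∑ v, K' h v * F' v := by
    calc ∑ v, u v * F' v = ∑ v, u v * ((1 - σ) * f v + σ * ∑ w, K' v w * F' w) := sum_congr rfl fun v _ => by rw [← hF v]
      _ = (1 - σ) * ∑ v, u v * f v + σ * ∑ h, u h * ∑ v, K' h v * F' v := by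
          rw [mul_sum, mul_sum, ← sum_add_distrib]; exact sum_congr rfl fun v _ => by ring
  have h3 : ∑ h, u h * ∑ v, (K h v - K' h v) * F' v = ∑ h, u h * ∑ v, K h v * F' v - ∑ h, u h * ∑ v, K' h v * F' v := by
    rw [← sum_sub_distrib]; refine sum_congr rfl fun h _ => ?_
    rw [← mul_sub, ← sum_sub_distrib]; congr 1; exact sum_congr rfl fun v _ => by ring
  rw [h3]
  field_simp
  linarith

/-- With equal row sums the inner sum may be centred: `Σ_v (K − K')(h,v)F'(v) = Σ_v (K − K')(h,v)(F'(v) − c)` for any constant `c`. [ours] -/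
theorem geomResolvent_compare_rowsum (hK1 : ∀ a, ∑ b, K a b = 1) (hK'1 : ∀ a, ∑ b, K' a b = 1) (h : S) (c : ℝ) :
    ∑ v, (K h v - K' h v) * F' v = ∑ v, (K h v - K' h v) * (F' v - c) := by
  have h0 : ∑ v, (K h v - K' h v) * c = 0 := by rw [← sum_mul, sum_sub_distrib, hK1, hK'1]; ring
  rw [← sub_eq_zero, ← sum_sub_distrib]
  rw [show (∑ v, ((K h v - K' h v) * F' v - (K h v - K' h v) * (F' v - c))) = ∑ v, (K h v - K' h v) * c from
    sum_congr rfl fun v _ => by ring, h0]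

/-- **THE FIRST-ORDER BOUND.**  Under the hypotheses of `geomResolvent_compare` with `u ≥ 0` of mass `Σν = 1`, `K, K' ≥ 0` stochastic, `0 ≤ σ`, `0 ≤ f ≤ 1`, and
`Σ_v |K(h,v) − K'(h,v)| ≤ δ` on the support of `u` (`K` with row sums one, `K' ≥ 0` stochastic): `|E_u f − E_{u'} f| ≤ (σ/(1−σ))·δ`. [ours] -/
theorem geomResolvent_compare_le (hK1 : ∀ a, ∑ b, K a b = 1) (hK'0 : ∀ a b, 0 ≤ K' a b) (hK'1 : ∀ a, ∑ b, K' a b = 1)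
    (hσ0 : 0 ≤ σ) (hσ1 : σ < 1) (hν1 : ∑ v, ν v = 1)
    (hu : ∀ v, u v = (1 - σ) * ν v + σ * ∑ h, u h * K h v) (hu0 : ∀ v, 0 ≤ u v)
    (hu' : ∀ v, u' v = (1 - σ) * ν v + σ * ∑ h, u' h * K' h v) (hu'0 : ∀ v, 0 ≤ u' v)
    (hF : ∀ v, F' v = (1 - σ) * f v + σ * ∑ w, K' v w * F' w) (hf0 : ∀ v, 0 ≤ f v) (hf1 : ∀ v, f v ≤ 1)
    {δ : ℝ} (hδ : ∀ h, u h ≠ 0 → ∑ v, |K h v - K' h v| ≤ δ) :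
    |∑ v, u v * f v - ∑ v, u' v * f v| ≤ σ / (1 - σ) * δ := by
  classical
  rw [geomResolvent_compare hσ1 hu hu' hu'0 hF]
  have hσ' : 0 ≤ σ / (1 - σ) := div_nonneg hσ0 (by linarith)
  rw [abs_mul, abs_of_nonneg hσ'] 
  refine mul_le_mul_of_nonneg_left ?_ hσ'
  have hFm : ∀ v, 0 ≤ F' v ∧ F' v ≤ 1 := geomValue_mem hK'0 hK'1 hσ0 hσ1 hF hf0 hf1
  -- inner sums are at most `δ` in absolute value on the support of `u`
  have hinner : ∀ h, u h ≠ 0 → |∑ v, (K h v - K' h v) * F' v| ≤ δ := by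
    intro h hh
    rw [geomResolvent_compare_rowsum hK1 hK'1 h (1 / 2)]
    calc |∑ v, (K h v - K' h v) * (F' v - 1 / 2)| ≤ ∑ v, |(K h v - K' h v) * (F' v - 1 / 2)| := abs_sum_le_sum_abs _ _
      _ ≤ ∑ v, |K h v - K' h v| * (1 / 2) := sum_le_sum fun v _ => by
          rw [abs_mul]; refine mul_le_mul_of_nonneg_left ?_ (abs_nonneg _)
          rw [abs_le]; constructor <;> linarith [(hFm v).1, (hFm v).2]
      _ ≤ δ * (1 / 2) := by rw [← sum_mul]; exact mul_le_mul_of_nonneg_right (hδ h hh) (by norm_num)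
      _ ≤ δ := by
          have : 0 ≤ δ := (sum_nonneg fun v _ => abs_nonneg _).trans (hδ h hh)
          linarith
  have hu1 : ∑ v, u v = 1 := by rw [geomResolvent_sum hK1 (ne_of_lt hσ1) hu, hν1]
  calc |∑ h, u h * ∑ v, (K h v - K' h v) * F' v| ≤ ∑ h, |u h * ∑ v, (K h v - K' h v) * F' v| := abs_sum_le_sum_abs _ _
    _ ≤ ∑ h, u h * δ := sum_le_sum fun h _ => by
        by_cases hh : u h = 0
        · rw [hh]; simp
        · rw [abs_mul, abs_of_nonneg (hu0 h)]; exact mul_le_mul_of_nonneg_left (hinner h hh) (hu0 h)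
    _ = δ := by rw [← sum_mul, hu1, one_mul]

end Compare

/-! ## §2 The star: the two hub chains of a pair state differ by at most `2Δ/K` per row -/

section StarCompare
variable {S : Type*} [Fintype S] [DecidableEq S]
variable {W : S → ℝ} {acc : S → S → ℝ} {K : ℕ} {NX NY : S → ℕ} {KX KY : S → S → ℝ}

/-- **Row difference of the two hub chains:** for a content `h` present in both compositions, `Σ_v |K_X(h,v) − K_Y(h,v)| ≤ 2·Σ_v |N_X(v) − N_Y(v)|/K`
(the off-diagonal part is `Σ_{v≠h} |N_X − N_Y|(v)acc(h,v)/K`, the diagonal compensates it). [ours] -/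
theorem starHub_rowDiff_le (hW : ∀ v, 0 < W v) (hacc : ∀ h v, acc h v = min 1 (W h / W v))
    (hKX : ∀ h v, h ≠ v → KX h v = if NX h = 0 then 0 else (NX v : ℝ) / K * acc h v) (hKXd : ∀ h, KX h h = 1 - ∑ v ∈ univ.erase h, KX h v)
    (hKY : ∀ h v, h ≠ v → KY h v = if NY h = 0 then 0 else (NY v : ℝ) / K * acc h v) (hKYd : ∀ h, KY h h = 1 - ∑ v ∈ univ.erase h, KY h v)
    (hK : 1 ≤ K) {h : S} (hhX : NX h ≠ 0) (hhY : NY h ≠ 0) :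
    ∑ v, |KX h v - KY h v| ≤ 2 * (∑ v, |(NX v : ℝ) - NY v|) / K := by
  have hK0 : (0 : ℝ) < K := by exact_mod_cast hK
  -- off-diagonal terms
  have hoff : ∀ v ∈ univ.erase h, |KX h v - KY h v| ≤ |(NX v : ℝ) - NY v| / K := by
    intro v hv
    have hvh : h ≠ v := (ne_of_mem_erase hv).symm
    rw [starHub_oneStep_diff hKX hKY hhX hhY hvh, abs_mul, abs_div, abs_of_pos hK0, abs_of_nonneg (starHub_acc_nonneg hW hacc h v)]
    calc |(NX v : ℝ) - NY v| / K * acc h v ≤ |(NX v : ℝ) - NY v| / K * 1 :=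
          mul_le_mul_of_nonneg_left (starHub_acc_le_one hacc h v) (div_nonneg (abs_nonneg _) hK0.le)
      _ = _ := mul_one _
  have hoffsum : ∑ v ∈ univ.erase h, |KX h v - KY h v| ≤ (∑ v, |(NX v : ℝ) - NY v|) / K := by
    calc ∑ v ∈ univ.erase h, |KX h v - KY h v| ≤ ∑ v ∈ univ.erase h, |(NX v : ℝ) - NY v| / K := sum_le_sum hoff
      _ ≤ ∑ v, |(NX v : ℝ) - NY v| / K := sum_le_sum_of_subset_of_nonneg (erase_subset _ _) fun v _ _ => div_nonneg (abs_nonneg _) hK0.le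
      _ = _ := by rw [sum_div]
  -- diagonal term: minus the sum of the off-diagonal differences
  have hdiag : KX h h - KY h h = -∑ v ∈ univ.erase h, (KX h v - KY h v) := by rw [hKXd, hKYd, sum_sub_distrib]; ring
  have hdiag_le : |KX h h - KY h h| ≤ (∑ v, |(NX v : ℝ) - NY v|) / K := by
    rw [hdiag, abs_neg]; exact (abs_sum_le_sum_abs _ _).trans hoffsum
  rw [← Finset.sum_erase_add univ _ (mem_univ h), mul_div_assoc]
  linarith

/-- **THE TWO END-HUB LAWS OF A PAIR STATE DIFFER BY AT MOST `(σ/(1−σ))·2Δ₁/K` IN EVERY `[0,1]`-VALUED FUNCTIONAL** (`Δ₁ = Σ|N_X − N_Y|`), provided the first resolvent only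
charges contents present in both compositions (e.g. by `geomResolvent_support_subset` when the contents of `N_X` are contents of `N_Y`; in general restrict `f` or split). [ours] -/
theorem starHub_endHub_compare_le (hW : ∀ v, 0 < W v) (hacc : ∀ h v, acc h v = min 1 (W h / W v))
    (hKX : ∀ h v, h ≠ v → KX h v = if NX h = 0 then 0 else (NX v : ℝ) / K * acc h v) (hKXd : ∀ h, KX h h = 1 - ∑ v ∈ univ.erase h, KX h v)
    (hKY : ∀ h v, h ≠ v → KY h v = if NY h = 0 then 0 else (NY v : ℝ) / K * acc h v) (hKYd : ∀ h, KY h h = 1 - ∑ v ∈ univ.erase h, KY h v)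
    (hK : 1 ≤ K) (hsumY : ∑ v, NY v = K + 1) {σ : ℝ} (hσ0 : 0 ≤ σ) (hσ1 : σ < 1)
    {ν uX uY f F' : S → ℝ} (hν1 : ∑ v, ν v = 1)
    (huX : ∀ v, uX v = (1 - σ) * ν v + σ * ∑ h, uX h * KX h v) (huX0 : ∀ v, 0 ≤ uX v)
    (huY : ∀ v, uY v = (1 - σ) * ν v + σ * ∑ h, uY h * KY h v) (huY0 : ∀ v, 0 ≤ uY v)
    (hF : ∀ v, F' v = (1 - σ) * f v + σ * ∑ w, KY v w * F' w) (hf0 : ∀ v, 0 ≤ f v) (hf1 : ∀ v, f v ≤ 1)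
    (hlegal : ∀ h, uX h ≠ 0 → NX h ≠ 0 ∧ NY h ≠ 0) :
    |∑ v, uX v * f v - ∑ v, uY v * f v| ≤ σ / (1 - σ) * (2 * (∑ v, |(NX v : ℝ) - NY v|) / K) :=
  geomResolvent_compare_le (starHub_rowsum hKXd) (starHub_nonneg hW hacc hKY hKYd hK hsumY) (starHub_rowsum hKYd)
    hσ0 hσ1 hν1 huX huX0 huY huY0 hF hf0 hf1 fun h hh => starHub_rowDiff_le hW hacc hKX hKXd hKY hKYd hK (hlegal h hh).1 (hlegal h hh).2

end StarCompare

end Summit.Ventures.LatticeQCDFlow.Scaling
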